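import Summits.Ventures.YMGap.Thresholds.StarSU3CertifiedRows
import HarnessLib

/-!
# Venture YMGap — `SU(3)`, `d = 4`: the cell's TARGET TYPE `ImprovedThreshold 4 3 (11/180)` on the two certified one-link inequalities

HONEST FRAMING: venture file of the cell `pub-ymgap` (QuantumFields programme), seat engine-2 (g4).  Strong-coupling LATTICE statement
only (`SU(3)` lattice Yang–Mills on `ℤ⁴`, Wilson action, 't Hooft coupling `x = β_W/9`); nothing about the continuum, weak coupling, or the
Clay problem.  Three lines of kernel ARITHMETIC over this seat's `StarSU3Certified.su3_massGapAt_abs_le_of_certificates`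
(`MassGapAt 4 3 (β_W/9)` at every Wilson `|β_W| ≤ 11/20`): in the shape of the cell's track-(a) target type
`ImprovedThreshold d N x₀ := 1/(16(d−1)) < x₀ ∧ (∀ x, |x| < x₀ → MassGapAt d N x)` this is `ImprovedThreshold 4 3 (11/180)` —
't Hooft `11/180 = 0.06111…` — GIVEN the two displayed certified finite-dimensional inequalities H1 `OneLinkPoincareSUN 3 (3/5) (4/5)`
(`pub-ymgap` σ2 engines) and H2 `OneLinkVarianceBound 3 (11/30) (49/20)` (`pub-balaban` g17 + `pub-ymgap` replay); NOTHING is asserted about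
them here; class «K × C⁻(H1) × C-iv(H2)» (cell rule R137) — never K.

COMPARISON in the same type: hypothesis-free `ImprovedThreshold 4 3 (9/308)` (`StarSUNLimit.su3_improvedThreshold`, 't Hooft `0.02922…`, K);
the sharp Bakry–Émery target `1/32 = 0.03125` (OBJECT U of the cell); printed Shen–Zhu–Zhu `1/48 = 0.02083…`.  Ratios: `× 847/405 = 2.09` over
`9/308`, `× 88/45 = 1.96` over `1/32`, `× 44/15 = 2.93` over print.  No rate beyond `∃ c > 0`.
-/

noncomputable section

open Summit.QuantumFields.BalabanUV.InfraRed.StrongCouplingVarianceDoorSUN (OneLinkVarianceBound)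
open Summit.QuantumFields.BalabanUV.InfraRed.StrongCouplingPoincareDoorSUN (OneLinkPoincareSUN)
open Summit.Ventures.YMGap.StarSU3Certified (su3_massGapAt_abs_le poincare_elevenThirtieths_of_threeFifths)

namespace Summit.Ventures.YMGap.StarSU3CertifiedThreshold

/-- **`MassGapBelow 4 3 (11/180)`** — `MassGapAt 4 3 x` at every 't Hooft `|x| < 11/180` (Wilson `|β_W| < 11/20`) — GIVEN the radius-`11/30`
Poincaré hypothesis `OneLinkPoincareSUN 3 (11/30) (4/5)` and `OneLinkVarianceBound 3 (11/30) (49/20)` (generic form). [folklore] -/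
theorem su3_massGapBelow (hP : OneLinkPoincareSUN 3 (11 / 30) (4 / 5)) (hv : OneLinkVarianceBound 3 (11 / 30) (49 / 20)) :
    MassGapBelow 4 3 (11 / 180) := by
  intro x hx
  have e : 9 * x / 9 = x := by ring
  rw [← e]
  refine su3_massGapAt_abs_le hP hv ?_
  rw [abs_mul, abs_of_pos (by norm_num : (0 : ℝ) < 9)]
  have := abs_nonneg x
  linarith [le_of_lt hx]

/-- ★ **THE CELL'S TARGET TYPE FOR `SU(3)`, `d = 4`, ON THE CERTIFICATES: `ImprovedThreshold 4 3 (11/180)`** — `1/48 < 11/180` and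
`MassGapAt 4 3 x` (DLR uniqueness + the Shen–Zhu–Zhu covariance clause for every DLR state) at every 't Hooft `|x| < 11/180 = 0.0611…`
(Wilson `|β_W| < 11/20`), GIVEN exactly H1 `OneLinkPoincareSUN 3 (3/5) (4/5)` and H2 `OneLinkVarianceBound 3 (11/30) (49/20)` (certified
computations, displayed; class «K × C⁻(H1) × C-iv(H2)», R137).  Same type, hypothesis-free: `9/308` (`StarSUNLimit.su3_improvedThreshold`);
sharp Bakry–Émery target `1/32`; printed `1/48`. [folklore] -/
theorem su3_improvedThreshold_of_certificates (hP : OneLinkPoincareSUN 3 (3 / 5) (4 / 5))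
    (hv : OneLinkVarianceBound 3 (11 / 30) (49 / 20)) : ImprovedThreshold 4 3 (11 / 180) :=
  ⟨by norm_num, su3_massGapBelow (poincare_elevenThirtieths_of_threeFifths hP) hv⟩

/-- The same on `pub-balaban`'s leaf-(41) Poincaré instance `OneLinkPoincareSUN 3 (11/30) (53/100)` (two engines there). [folklore] -/
theorem su3_improvedThreshold_of_sharp_pair (hP : OneLinkPoincareSUN 3 (11 / 30) (53 / 100))
    (hv : OneLinkVarianceBound 3 (11 / 30) (49 / 20)) : ImprovedThreshold 4 3 (11 / 180) :=
  ⟨by norm_num, su3_massGapBelow (StarSU3Certified.poincare_fourFifths_of_sharp hP) hv⟩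

/-- Numbers: `1/48 < 9/308 < 1/32 < 11/180`; `11/180 = (11/20)/9`; ratios `(11/180)/(9/308) = 847/405`, `(11/180)/(1/32) = 88/45`,
`(11/180)/(1/48) = 44/15`. [folklore] -/
theorem threshold_numbers :
    (1 : ℝ) / 48 < 9 / 308 ∧ (9 : ℝ) / 308 < 1 / 32 ∧ (1 : ℝ) / 32 < 11 / 180 ∧ (11 : ℝ) / 20 / 9 = 11 / 180 ∧
      (11 : ℝ) / 180 / (9 / 308) = 847 / 405 ∧ (11 : ℝ) / 180 / (1 / 32) = 88 / 45 ∧ (11 : ℝ) / 180 / (1 / 48) = 44 / 15 := by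
  norm_num

end Summit.Ventures.YMGap.StarSU3CertifiedThreshold

end
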